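import Literature.AlgebraicGeometry.Frobenioids.ArithmeticFrobenioids
import HarnessLib

/-!
# Frobenioids I, Theorem 6.4 (ii): the degree of `Ψ^rlf` from order-compatibility — the composition step
# of the printed proof — PROOF

Mochizuki, *The geometry of Frobenioids I: the general theory*, Kyushu J. Math. **62** (2008) 293–400,
Theorem 6.4 (ii), kurims text p. 114: "there exists an element `deg(Ψ^rlf) ∈ ℝ_{>0}` … such that the
isomorphism `Pic_Φ(A₁) ⥲ Pic_Φ(A₂)` induced by `Ψ^rlf` is compatible with `δ_{A₁}`, `δ_{A₂}` up to the factor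
`deg(Ψ^rlf)`"; proof p. 115 l. 34 – p. 116 l. 3: "the isomorphism of groups `Pic_Φ(A₁) ⥲ Pic_Φ(A₂)` determined by
`Ψ^rlf` … is compatible with the 'order structure' induced on both sides by the 'order structure' of `ℝ`
… assertion (ii) follows immediately". [cite: MochizukiFrdI2008, Thm. 6.4 (ii) p.114]

PROOF-ONLY (seat abc-iut-L6-t10, S3 sub-DAG holder; the composition row **T64ii/L02 + L04 ⟹ (ii) via L03**
of `HOME/staging/L1/L1-t1/gen2/S3-LEMMA-LIST.md`, i.e. abc-iut-L1-t1's `Thm64ii_of_orderCompat`, with the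
classical step T64ii/L03 — an order-preserving additive bijection of `ℝ` is `x ↦ c · x`, `c > 0` — taken as the
explicit hypothesis `h03` (its discharge `Thm64ii_L03_monotoneAddAut_holds` is abc-iut-L1-t1's)). PROVED, over
abc-iut-L1-t3's schema `ArithRealification` / `Thm64ii` (v3, `Thm64iiDeg`):
* `Thm64ii_of_monotone` — if for every Frobenius-trivial `A` the composite `ℝ ≃ Pic_Φ(A) ≃ Pic_Φ(Ψ A) ≃ ℝ`
  (`δ_{A₂} ∘ picMap ∘ δ_{A₁}⁻¹`) is monotone (T64ii/L02) and does not depend on `A` (T64ii/L04), then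
  `Thm64ii R₁ R₂ Ψ picMap`: the common composite is `t ↦ deg · t` with `deg > 0` (T64ii/L03), and `deg := 1`
  if no Frobenius-trivial object exists.
No definitions; nothing here bears on [IUTchIII] or asserts anything about abc.
-/

noncomputable section

namespace Literature.AlgebraicGeometry.Frobenioids

open CategoryTheory

universe u v

variable {F₁ : Type} [Field F₁] {K₁ : Type} [Field K₁] [Algebra F₁ K₁]
variable {F₂ : Type} [Field F₂] {K₂ : Type} [Field K₂] [Algebra F₂ K₂]
variable {Rlf₁ : Type u} [Category.{v} Rlf₁] {Rlf₂ : Type u} [Category.{v} Rlf₂]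
variable (R₁ : ArithRealification (F := F₁) (K := K₁) Rlf₁) (R₂ : ArithRealification (F := F₂) (K := K₂) Rlf₂)

/-- **Theorem 6.4 (ii), composition step** (FrdI p. 114; proof p. 115 l. 34 – p. 116 l. 3) — PROVED over the
schema: given the classical fact `h03` (an order-preserving additive bijection `ℝ → ℝ` is multiplication by a
positive real; T64ii/L03), order-compatibility of `δ_{A₂} ∘ picMap_A ∘ δ_{A₁}⁻¹` for every Frobenius-trivial `A`
(T64ii/L02) and its independence of `A` (T64ii/L04) yield a degree `deg(Ψ^rlf) > 0` with
`δ_{A₂}(picMap_A x) = deg · δ_{A₁}(x)` (`Thm64ii`). [cite: MochizukiFrdI2008, Thm. 6.4 (ii) p.114] -/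
theorem Thm64ii_of_monotone
    (h03 : ∀ φ : ℝ ≃+ ℝ, Monotone φ → ∃ c : ℝ, 0 < c ∧ ∀ x : ℝ, φ x = c * x)
    (Ψ : Rlf₁ ≌ Rlf₂) (picMap : ∀ A : Rlf₁, R₁.Pic A ≃+ R₂.Pic (Ψ.functor.obj A))
    (hmono : ∀ (A : Rlf₁) (hA : R₁.ops.IsFrobeniusTrivial A)
      (hA' : R₂.ops.IsFrobeniusTrivial (Ψ.functor.obj A)),
      Monotone fun t : ℝ => R₂.δ _ hA' (picMap A ((R₁.δ A hA).symm t)))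
    (hunif : ∀ (A B : Rlf₁) (hA : R₁.ops.IsFrobeniusTrivial A)
      (hA' : R₂.ops.IsFrobeniusTrivial (Ψ.functor.obj A)) (hB : R₁.ops.IsFrobeniusTrivial B)
      (hB' : R₂.ops.IsFrobeniusTrivial (Ψ.functor.obj B)) (t : ℝ),
      R₂.δ _ hA' (picMap A ((R₁.δ A hA).symm t)) = R₂.δ _ hB' (picMap B ((R₁.δ B hB).symm t))) :
    Thm64ii R₁ R₂ Ψ picMap := by
  by_cases hex : ∃ (A : Rlf₁) (_ : R₁.ops.IsFrobeniusTrivial A), R₂.ops.IsFrobeniusTrivial (Ψ.functor.obj A)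
  · obtain ⟨A₀, hA₀, hA₀'⟩ := hex
    -- the composite `ℝ ≃ Pic(A₀) ≃ Pic(Ψ A₀) ≃ ℝ`
    let φ : ℝ ≃+ ℝ := ((R₁.δ A₀ hA₀).symm.trans (picMap A₀)).trans (R₂.δ _ hA₀')
    have hφ : ∀ t, φ t = R₂.δ _ hA₀' (picMap A₀ ((R₁.δ A₀ hA₀).symm t)) := fun t => rfl
    obtain ⟨c, hc, hcφ⟩ := h03 φ (fun s t hst => by rw [hφ, hφ]; exact hmono A₀ hA₀ hA₀' hst)
    refine ⟨c, hc, fun A hA hA' x => ?_⟩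
    have hx : x = (R₁.δ A hA).symm (R₁.δ A hA x) := ((R₁.δ A hA).symm_apply_apply x).symm
    conv_lhs => rw [hx]
    rw [hunif A A₀ hA hA' hA₀ hA₀', ← hφ, hcφ]
  · refine ⟨1, one_pos, fun A hA hA' x => ?_⟩
    exact absurd ⟨A, hA, hA'⟩ hex

end Literature.AlgebraicGeometry.Frobenioids

end
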